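import Summits.AnomalousDissipation.AnomalousDissipation.Cruxes.GPMeanBoundedFamily.Disproof
import Summits.AnomalousDissipation.AnomalousDissipation.Cruxes.GPMeanBoundedFamily.CensusSketch
import Summits.AnomalousDissipation.AnomalousDissipation.Theorems.EnsembleRigidityResidualTransferSSS
import Summits.AnomalousDissipation.AnomalousDissipation.Theorems.EnsembleRigidityEnsembleFloorTransfer
import Summits.AnomalousDissipation.AnomalousDissipation.Theorems.TaylorCertificatesSteadyWeakIsGlobalLerayHopf
import Literature.Analysis.FluidPDE.SteadyNavierStokesEnergy

/-!
# STRATEGY CENSUS, Part II — typed companion (crux `GPMeanBoundedFamily` = `B`, stmt-AnomalousDissipation-15509)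

Crux-strategist seat `planner-cstrat-stmt-AnomalousDissipation-15509-0` (route EnsembleRigidity, gen 1), running
alongside lead c2 of line `Sketch`.  Builds on the Part-I companion `CensusSketch.lean` (seat b1, namespace
`…StrategyCensus`: `B`, `IsLiftedFamily`, `crux_iff`, `GPZerothLawLifted`, relative floor, ensemble split, rest
divergence) and on `Disproof.lean` (cdisprove: `perViscosity_ceiling`, level floor).  Prose: `STRATEGY-CENSUS.md`
Part II.  Everything here is `sorry`-free; nothing closes the item.

* §D5 DICHOTOMY.  `QuietBoundedLiftedFamily` (a mean-bounded lifted family whose mean dissipation is not bounded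
  away from `0`) and `crux_iff_zerothLaw_or_quiet : B ↔ GPZerothLawLifted ∨ QuietBoundedLiftedFamily` — every
  proof of `B` proves the lifted zeroth law AT f_GP (summit-strength) or produces a quiet bounded family.
* §D7 RIGIDITY MAKES EVERY BOUNDED FAMILY LOUD (UNCONDITIONAL in the two landed bridges
  `ResidualTransferSSS_of`, `EnsembleFloorTransfer_proof`).  `loud_of_rigidity` — under X1 =
  `GPStatisticalRigidity` every mean-bounded lifted family has a positive dissipation floor; hence
  `crux_iff_zerothLaw_of_rigidity : X1 → (B ↔ GPZerothLawLifted)` (given the route's other open crux, `B` IS the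
  summit at f_GP — not merely its necessary half) and `not_rigidity_of_quiet : QuietBoundedLiftedFamily → ¬ X1`
  (a quiet proof of `B` closes the item by killing the route).  This is the formal content of "short of the
  summit, the only proofs of B available to THIS route are route-killers".
* §S6 EXPONENT LADDER.  `ExponentBoundedFamily α` (some lifted family with `ν_j ^ α · meanEnergy (u_j) ≤ C`):
  `crux_iff_exponent_zero : B ↔ ExponentBoundedFamily 0`, `exponent_mono` (the rungs are nested because
  `ν_j ≤ 1`), `exponent_two : ExponentBoundedFamily 2` (the laminar rung, from `Disproof.perViscosity_ceiling`).
  Every rung `α < 2` ("f_GP is not asymptotically laminar along SOME family") is OPEN; the stochastic sibling of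
  the rung `α = 1` is Bedrossian–Coti Zelati–Punshon-Smith–Weber's (WAD), printed open (arXiv:1803.09695, Def. 1.1,
  §7 problem 1).
* §N7 NEGATION, STEADY FORM.  `SteadyStatesDiverge` (for every level, at all small ν EVERY steady weak solution in
  `V` of NS_ν(f_GP) has energy above the level) and `steadyStatesDiverge_of_not_crux : ¬ B → SteadyStatesDiverge`
  (route-A glue of the live skeleton run backwards: Temam's energy equality + `SteadyWeakIsGlobalLerayHopf`).  The
  primary G-symmetric steady branch (E = 0.19 … 0.86 for Re = 16 … 562, LINE-REPORT-c2) is what contradicts it so far.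
-/

noncomputable section

set_option linter.dupNamespace false

open MeasureTheory Filter Topology Set

namespace Summit.AnomalousDissipation.AnomalousDissipation.Cruxes.GPMeanBoundedFamily.StrategyCensusG1

open Literature.Analysis Literature.Analysis.FunctionSpaces Literature.Analysis.FluidPDE
open Summit.AnomalousDissipation.AnomalousDissipation.Theorems.EnsembleRigidity (gpForce gpForce_eq)
open Summit.AnomalousDissipation.AnomalousDissipation.Theses.EnsembleRigidity
  (GPStatisticalRigidity ResidualTransferSSS EnsembleFloorTransfer)
open Summit.AnomalousDissipation.AnomalousDissipation.Cruxes.GPMeanBoundedFamily.StrategyCensus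
  (B IsLift IsLiftedFamily GPZerothLawLifted crux_iff gpForce_admissible crux_of_gpZerothLawLifted
    anomalousDissipation_of_gpZerothLawLifted)

/-! ## §D5 The dichotomy: a proof of `B` is the lifted zeroth law at f_GP or a quiet bounded family -/

/-- **Quiet bounded lifted family**: a witness family of `B` (lifted Leray–Hopf paths of NS_{ν_j}(f_GP),
`ν_j → 0`, `meanEnergy ≤ E`) whose mean dissipation rates are NOT bounded away from zero
(`inf_j ⟨ν_j‖∇u_j‖²⟩ = 0`). -/
def QuietBoundedLiftedFamily : Prop :=
  ∃ (E : ℝ) (ν : ℕ → ℝ) (u₀ : ℕ → UnitAddTorus (Fin 3) → EuclideanSpace ℝ (Fin 3))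
    (u : ℕ → ℝ → UnitAddTorus (Fin 3) → EuclideanSpace ℝ (Fin 3)) (U : ℕ → ℝ → Torus.energySpace (Fin 3)),
    IsLiftedFamily ν u₀ u U ∧ (∀ j, meanEnergy (u j) ≤ E) ∧
      ∀ ε : ℝ, 0 < ε → ∃ j, meanDissipation (ν j) (u j) < ε

/-- **`B ↔ (lifted zeroth law at f_GP) ∨ (quiet bounded family)`.**  Excluded middle on
`∃ ε > 0, ∀ j, ε ≤ meanDissipation (ν_j) (u_j)` for a witness family; both disjuncts project back to `B`. -/
theorem crux_iff_zerothLaw_or_quiet : B ↔ GPZerothLawLifted ∨ QuietBoundedLiftedFamily := by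
  constructor
  · intro h
    obtain ⟨E, ν, u₀, u, U, hfam, hE⟩ := crux_iff.mp h
    by_cases hloud : ∃ ε : ℝ, 0 < ε ∧ ∀ j, ε ≤ meanDissipation (ν j) (u j)
    · exact Or.inl ⟨ν, u₀, u, U, hfam, ⟨E, hE⟩, hloud⟩
    · refine Or.inr ⟨E, ν, u₀, u, U, hfam, hE, fun ε hε => ?_⟩
      by_contra hcon
      push Not at hcon
      exact hloud ⟨ε, hε, hcon⟩
  · rintro (h | ⟨E, ν, u₀, u, U, hfam, hE, -⟩)
    · exact crux_of_gpZerothLawLifted h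
    · exact crux_iff.mpr ⟨E, ν, u₀, u, U, hfam, hE⟩

/-! ## §D7 Under the rigidity crux X1 every bounded family is loud (landed bridges, unconditional) -/

/-- **Ensemble dissipation floor at level `E` from X1** — the `floor` block of the route's `closes`, with the
LANDED `ResidualTransferSSS_of` in place of the hypothesis `h₄`: for `ν' ∈ (0,1]` every stationary statistical
solution of NS_{ν'}(f_GP) with integrable energy `≤ E` has `ensembleDissipation ≥ ε₀ := min c δ₀²`. -/
theorem ensembleFloor_of_rigidity (hX : GPStatisticalRigidity) (E : ℝ) :
    ∃ ε₀ : ℝ, 0 < ε₀ ∧ ∀ ν' : ℝ, 0 < ν' → ν' ≤ 1 →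
      ∀ μ : Measure (Torus.energySpace (Fin 3)), Torus.IsStationaryStatisticalSolution ν' gpForce μ →
        Integrable (fun v : Torus.energySpace (Fin 3) => ‖v‖ ^ 2) μ → Torus.ensembleEnergy μ ≤ E →
        ε₀ ≤ Torus.ensembleDissipation ν' μ := by
  obtain ⟨hsm, hdf, hzm⟩ := gpForce_admissible
  obtain ⟨c, δ₀, hc, hδ₀, hrig⟩ := hX gpForce gpForce_eq E
  refine ⟨min c (δ₀ ^ 2), lt_min hc (pow_pos hδ₀ 2), ?_⟩
  intro ν' hν' hν'1 μ hμ hint hEμ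
  have h₄ : ResidualTransferSSS :=
    Summit.AnomalousDissipation.AnomalousDissipation.Theorems.ResidualTransferSSS.ResidualTransferSSS_of
  have hfin : Torus.ensembleEnstrophy μ < ⊤ := hμ.enstrophy_finite
  obtain ⟨hshell, hres⟩ := h₄ ν' gpForce μ hν' hsm hdf hzm hμ hint
  set G : ℝ := (Torus.ensembleEnstrophy μ).toReal with hG
  have hG0 : 0 ≤ G := ENNReal.toReal_nonneg
  have hsq : Real.sqrt G * Real.sqrt G = G := Real.mul_self_sqrt hG0
  set R : ℝ := ν' * Real.sqrt G with hR
  have hR0 : 0 ≤ R := mul_nonneg hν'.le (Real.sqrt_nonneg _)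
  have hdiss : Torus.ensembleDissipation ν' μ = ν' * G := rfl
  rw [hdiss]
  by_cases hRδ : R ≤ δ₀
  · -- rigidity branch: c ≤ R √G = ν' G
    have key := hrig μ hμ.prob hint hEμ hfin hshell R hR0 hRδ
      (fun Φ => ⟨(hres Φ).1, by simpa [hR, mul_assoc] using (hres Φ).2⟩)
    have : R * Real.sqrt G = ν' * G := by rw [hR, mul_assoc, hsq]
    calc min c (δ₀ ^ 2) ≤ c := min_le_left _ _
      _ ≤ R * Real.sqrt G := key
      _ = ν' * G := this
  · -- large-residual branch: ν' G = R² / ν' ≥ R² > δ₀²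
    have hRgt : δ₀ < R := lt_of_not_ge hRδ
    have hR2 : δ₀ ^ 2 < R ^ 2 := by
      have := hδ₀.le
      nlinarith
    have hRsq : R ^ 2 = ν' * (ν' * G) := by
      have hsq2 : Real.sqrt G ^ 2 = G := Real.sq_sqrt hG0
      calc R ^ 2 = ν' ^ 2 * Real.sqrt G ^ 2 := by rw [hR]; ring
        _ = ν' * (ν' * G) := by rw [hsq2]; ring
    have hνG0 : 0 ≤ ν' * G := mul_nonneg hν'.le hG0
    have hle : R ^ 2 ≤ ν' * G := by
      rw [hRsq]
      calc ν' * (ν' * G) ≤ 1 * (ν' * G) := mul_le_mul_of_nonneg_right hν'1 hνG0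
        _ = ν' * G := one_mul _
    calc min c (δ₀ ^ 2) ≤ δ₀ ^ 2 := min_le_right _ _
      _ ≤ R ^ 2 := hR2.le
      _ ≤ ν' * G := hle

/-- **X1 makes every mean-bounded lifted family LOUD** (ensemble floor + the landed `EnsembleFloorTransfer_proof`). -/
theorem loud_of_rigidity (hX : GPStatisticalRigidity) {E : ℝ} {ν : ℕ → ℝ}
    {u₀ : ℕ → UnitAddTorus (Fin 3) → EuclideanSpace ℝ (Fin 3)} {u : ℕ → ℝ → UnitAddTorus (Fin 3) → EuclideanSpace ℝ (Fin 3)}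
    {U : ℕ → ℝ → Torus.energySpace (Fin 3)} (hfam : IsLiftedFamily ν u₀ u U) (hE : ∀ j, meanEnergy (u j) ≤ E) :
    ∃ ε₀ : ℝ, 0 < ε₀ ∧ ∀ j, ε₀ ≤ meanDissipation (ν j) (u j) := by
  obtain ⟨ε₀, hε₀, hfloor⟩ := ensembleFloor_of_rigidity hX E
  obtain ⟨hsm, hdf, hzm⟩ := gpForce_admissible
  obtain ⟨hν, -, hLH, hlift⟩ := hfam
  have h₅ : EnsembleFloorTransfer :=
    Summit.AnomalousDissipation.AnomalousDissipation.Theorems.EnsembleFloorTransfer_proof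
  refine ⟨ε₀, hε₀, fun j => ?_⟩
  exact h₅ (ν j) E ε₀ gpForce (u₀ j) (u j) (U j) (hν j).1 hsm hdf hzm (hfloor (ν j) (hν j).1 (hν j).2)
    (hLH j) (hlift j) (hE j)

/-- Under X1, every witness of `B` is already a witness of the LIFTED ZEROTH LAW at f_GP. -/
theorem gpZerothLawLifted_of_rigidity_of_crux (hX : GPStatisticalRigidity) (hB : B) : GPZerothLawLifted := by
  obtain ⟨E, ν, u₀, u, U, hfam, hE⟩ := crux_iff.mp hB
  exact ⟨ν, u₀, u, U, hfam, ⟨E, hE⟩, loud_of_rigidity hX hfam hE⟩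

/-- **X1 → (B ↔ lifted zeroth law at f_GP).**  Given the route's other open crux, `B` is not only the necessary
half of the summit at f_GP (`crux_of_gpZerothLawLifted`, Part I) but EQUIVALENT to it. -/
theorem crux_iff_zerothLaw_of_rigidity (hX : GPStatisticalRigidity) : B ↔ GPZerothLawLifted :=
  ⟨gpZerothLawLifted_of_rigidity_of_crux hX, crux_of_gpZerothLawLifted⟩

/-- X1 and `B` decide the summit (the route's assembly, re-derived through the dichotomy). -/
theorem anomalousDissipation_of_rigidity_of_crux (hX : GPStatisticalRigidity) (hB : B) :
    _root_.AnomalousDissipation :=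
  anomalousDissipation_of_gpZerothLawLifted (gpZerothLawLifted_of_rigidity_of_crux hX hB)

/-- **A quiet bounded family kills the route's rigidity crux** (unconditionally, through the landed bridges):
so a proof of `B` by quiet objects (exact or near dodgers, quiet steady/periodic branches with bounded energy)
closes the item and refutes `GPStatisticalRigidity` at the same time. -/
theorem not_rigidity_of_quiet (hq : QuietBoundedLiftedFamily) : ¬ GPStatisticalRigidity := by
  intro hX
  obtain ⟨E, ν, u₀, u, U, hfam, hE, hquiet⟩ := hq
  obtain ⟨ε₀, hε₀, hloud⟩ := loud_of_rigidity hX hfam hE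
  obtain ⟨j, hj⟩ := hquiet ε₀ hε₀
  exact absurd (hloud j) (not_le.mpr hj)

/-- The dichotomy restated: `B` holds iff (X1 fails because of a quiet bounded family) or (the summit holds at
f_GP with lifts).  -/
theorem crux_cases (hB : B) : GPZerothLawLifted ∨ (QuietBoundedLiftedFamily ∧ ¬ GPStatisticalRigidity) := by
  rcases crux_iff_zerothLaw_or_quiet.mp hB with h | h
  · exact Or.inl h
  · exact Or.inr ⟨h, not_rigidity_of_quiet h⟩

/-! ## §S6 The exponent ladder `ν_j^α · E_j ≤ C` -/

/-- **B_α**: some lifted family has `ν_j ^ α · meanEnergy (u_j) ≤ C` for all `j`.  `α = 0` is `B`; `α = 2` is the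
laminar (Leray-ball) rung; `α = 2/3` would be "at most Prandtl–Batchelor-warm"; `α = 1` is the deterministic cousin
of BCZPSW's weak anomalous dissipation scale. -/
def ExponentBoundedFamily (α : ℝ) : Prop :=
  ∃ (C : ℝ) (ν : ℕ → ℝ) (u₀ : ℕ → UnitAddTorus (Fin 3) → EuclideanSpace ℝ (Fin 3))
    (u : ℕ → ℝ → UnitAddTorus (Fin 3) → EuclideanSpace ℝ (Fin 3)) (U : ℕ → ℝ → Torus.energySpace (Fin 3)),
    IsLiftedFamily ν u₀ u U ∧ ∀ j, (ν j) ^ α * meanEnergy (u j) ≤ C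

/-- `B ↔ B₀`. -/
theorem crux_iff_exponent_zero : B ↔ ExponentBoundedFamily 0 := by
  rw [crux_iff]
  constructor
  · rintro ⟨E, ν, u₀, u, U, hfam, hE⟩
    exact ⟨E, ν, u₀, u, U, hfam, fun j => by simpa [Real.rpow_zero] using hE j⟩
  · rintro ⟨C, ν, u₀, u, U, hfam, hC⟩
    exact ⟨C, ν, u₀, u, U, hfam, fun j => by simpa [Real.rpow_zero] using hC j⟩

/-- The rungs are nested: `α ≤ β → B_α → B_β` (because `0 < ν_j ≤ 1` and `meanEnergy ≥ 0`). -/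
theorem exponent_mono {α β : ℝ} (hαβ : α ≤ β) (h : ExponentBoundedFamily α) : ExponentBoundedFamily β := by
  obtain ⟨C, ν, u₀, u, U, hfam, hC⟩ := h
  refine ⟨C, ν, u₀, u, U, hfam, fun j => ?_⟩
  have hν := hfam.1 j
  have hE0 : 0 ≤ meanEnergy (u j) := meanEnergy_nonneg (u j)
  have hpow : (ν j) ^ β ≤ (ν j) ^ α := Real.rpow_le_rpow_of_exponent_ge hν.1 hν.2 hαβ
  exact (mul_le_mul_of_nonneg_right hpow hE0).trans (hC j)

/-- **The laminar rung `α = 2` is a theorem** (`Disproof.perViscosity_ceiling`: the lifted family FROM REST at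
`ν_j = 1/(j+1)` has `meanEnergy ≤ 16‖f_GP‖²/ν_j² = 24/ν_j²`).  Every rung below it is open. -/
theorem exponent_two : ExponentBoundedFamily 2 := by
  have key : ∀ j : ℕ, ∃ (u : ℝ → UnitAddTorus (Fin 3) → EuclideanSpace ℝ (Fin 3)) (U : ℝ → Torus.energySpace (Fin 3)),
      Torus.IsGlobalLerayHopf (1 / ((j : ℝ) + 1)) (fun _ => gpForce) 0 u ∧ IsLift u U ∧
      meanEnergy u ≤ 16 * (∫ x, ‖gpForce x‖ ^ 2) / (1 / ((j : ℝ) + 1)) ^ 2 := fun j =>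
    Disproof.perViscosity_ceiling (1 / ((j : ℝ) + 1)) (by positivity)
  choose u U hu hU hE using key
  have hν : ∀ j : ℕ, 0 < 1 / ((j : ℝ) + 1) ∧ 1 / ((j : ℝ) + 1) ≤ 1 := fun j =>
    ⟨by positivity, by rw [div_le_one (by positivity)]; linarith [(Nat.cast_nonneg j : (0 : ℝ) ≤ j)]⟩
  refine ⟨16 * (∫ x, ‖gpForce x‖ ^ 2), fun j => 1 / ((j : ℝ) + 1), fun _ => 0, u, U,
    ⟨hν, tendsto_one_div_add_atTop_nhds_zero_nat, hu, hU⟩, fun j => ?_⟩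
  have hpos : 0 < (1 / ((j : ℝ) + 1)) ^ 2 := pow_pos (hν j).1 2
  have h1 : (1 / ((j : ℝ) + 1)) ^ (2 : ℝ) = (1 / ((j : ℝ) + 1)) ^ 2 := Real.rpow_two _
  rw [h1]
  calc (1 / ((j : ℝ) + 1)) ^ 2 * meanEnergy (u j)
      ≤ (1 / ((j : ℝ) + 1)) ^ 2 * (16 * (∫ x, ‖gpForce x‖ ^ 2) / (1 / ((j : ℝ) + 1)) ^ 2) :=
        mul_le_mul_of_nonneg_left (hE j) hpos.le
    _ = 16 * (∫ x, ‖gpForce x‖ ^ 2) := by field_simp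

/-! ## §N7 Negation, steady form: a disproof makes EVERY steady state diverge -/

/-- **Steady states diverge**: for every level `E` there is `ν₀ > 0` such that for `0 < ν < ν₀` EVERY steady weak
solution `u ∈ V` of NS_ν(f_GP) has `∫‖u‖² > E` (Leray–Schauder supplies steady states at every `ν`, so this is a
statement about all of them, the primary G-symmetric branch included). -/
def SteadyStatesDiverge : Prop :=
  ∀ E : ℝ, ∃ ν₀ : ℝ, 0 < ν₀ ∧ ∀ ν : ℝ, 0 < ν → ν < ν₀ → ∀ u : Torus.energySpace (Fin 3),
    (u : Lp (EuclideanSpace ℝ (Fin 3)) 2 (volume : Measure (UnitAddTorus (Fin 3)))) ∈ Torus.energySpaceV (Fin 3) →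
    Torus.IsSteadyWeakSolution ν gpForce u →
    E < ∫ x, ‖(u : Lp (EuclideanSpace ℝ (Fin 3)) 2 (volume : Measure (UnitAddTorus (Fin 3)))) x‖ ^ 2

/-- **`¬B → SteadyStatesDiverge`** (PROVED): if steady states of energy `≤ E` existed along arbitrarily small
viscosities, Temam's energy equality in `d = 3` and `SteadyWeakIsGlobalLerayHopf` (both in tree; this is the
route-A glue `GPMeanBoundedFamily_of` of `Lines/Sketch.lean` run on a chosen sequence) would make the constant paths
a witness family of `B`. -/
theorem steadyStatesDiverge_of_not_crux (h : ¬ B) : SteadyStatesDiverge := by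
  by_contra hcon
  apply h
  rw [crux_iff]
  unfold SteadyStatesDiverge at hcon
  push Not at hcon
  obtain ⟨E, hE⟩ := hcon
  obtain ⟨hfs, -, hfz⟩ := gpForce_admissible
  have hf2 : MemLp gpForce 2 (volume : Measure (UnitAddTorus (Fin 3))) := hfs.memLp 2
  -- one bounded steady state below each `ν₀ = 1/(j+1)`, realised as a constant Leray–Hopf path (its own lift)
  have key : ∀ j : ℕ, ∃ (ν : ℝ) (u : Torus.energySpace (Fin 3)), 0 < ν ∧ ν < 1 / ((j : ℝ) + 1) ∧
      Torus.IsGlobalLerayHopf ν (fun _ => gpForce)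
        ((u : Lp (EuclideanSpace ℝ (Fin 3)) 2 (volume : Measure (UnitAddTorus (Fin 3)))) :
          UnitAddTorus (Fin 3) → EuclideanSpace ℝ (Fin 3))
        (fun _ => ((u : Lp (EuclideanSpace ℝ (Fin 3)) 2 (volume : Measure (UnitAddTorus (Fin 3)))) :
          UnitAddTorus (Fin 3) → EuclideanSpace ℝ (Fin 3))) ∧
      meanEnergy (fun _ : ℝ => ((u : Lp (EuclideanSpace ℝ (Fin 3)) 2 (volume : Measure (UnitAddTorus (Fin 3)))) :
          UnitAddTorus (Fin 3) → EuclideanSpace ℝ (Fin 3))) ≤ E := fun j => by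
    obtain ⟨ν, hν, hνlt, u, hV, hsol, hEu⟩ := hE (1 / ((j : ℝ) + 1)) (by positivity)
    have heq : ν * (Torus.eGradNormSq ((u : Lp (EuclideanSpace ℝ (Fin 3)) 2
        (volume : Measure (UnitAddTorus (Fin 3)))) : UnitAddTorus (Fin 3) → EuclideanSpace ℝ (Fin 3))).toReal =
          Torus.pairing (u : Lp (EuclideanSpace ℝ (Fin 3)) 2 (volume : Measure (UnitAddTorus (Fin 3)))) gpForce :=
      Torus.Temam1979_steadyWeakSolution_energy_eq_holds
        (by norm_num [Fintype.card_fin] : Fintype.card (Fin 3) ≤ 4) hf2 hV hsol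
    obtain ⟨hLH, hmean, -⟩ :=
      Summit.AnomalousDissipation.AnomalousDissipation.Theorems.taylorCertificates_steadyWeakIsGlobalLerayHopf_proof
        _ gpForce u hν hfs hfz hV hsol heq
    exact ⟨ν, u, hν, hνlt, hLH, hmean.le.trans hEu⟩
  choose ν u hν hνlt hLH hmean using key
  have hν1 : ∀ j, ν j ≤ 1 := fun j => by
    have h1 : 1 / ((j : ℝ) + 1) ≤ 1 := by
      rw [div_le_one (by positivity)]; linarith [(Nat.cast_nonneg j : (0 : ℝ) ≤ j)]
    exact (hνlt j).le.trans h1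
  have hν0 : Tendsto ν atTop (nhds 0) :=
    squeeze_zero (fun j => (hν j).le) (fun j => (hνlt j).le) tendsto_one_div_add_atTop_nhds_zero_nat
  refine ⟨E, ν,
    fun j => ((u j : Lp (EuclideanSpace ℝ (Fin 3)) 2 (volume : Measure (UnitAddTorus (Fin 3)))) :
      UnitAddTorus (Fin 3) → EuclideanSpace ℝ (Fin 3)),
    fun j _ => ((u j : Lp (EuclideanSpace ℝ (Fin 3)) 2 (volume : Measure (UnitAddTorus (Fin 3)))) :
      UnitAddTorus (Fin 3) → EuclideanSpace ℝ (Fin 3)),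
    fun j _ => u j, ⟨fun j => ⟨hν j, hν1 j⟩, hν0, hLH, fun j t _ => Filter.EventuallyEq.rfl⟩, hmean⟩

end Summit.AnomalousDissipation.AnomalousDissipation.Cruxes.GPMeanBoundedFamily.StrategyCensusG1

end
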